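/-
Copyright (c) 2026. All rights reserved.
Released under Apache 2.0 license as described in the file LICENSE.
Authors: abc-iut cell, seat abc-iut-f-072 (gen 4; classical corollary of the cell's Neukirch–Uchida theorem).
-/
import Literature.AnabelianGeometry.AbsoluteAnabelian.NeukirchUchidaInnerAutomorphisms
import Literature.AnabelianGeometry.AbsoluteAnabelian.NeukirchUchidaUnconditional
import HarnessLib

/-!
# Outer automorphisms of `Gal(F̄/F)` for a number field `F` come exactly from `Aut(F)`

J. Neukirch, A. Schmidt, K. Wingberg, *Cohomology of Number Fields* (2nd ed. 2008), §XII.2, Thm. (12.2.1)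
and its corollaries; S. Mochizuki, *The absolute anabelian geometry of hyperbolic curves* (2004), Thm. 1.1.3.

PROOF-ONLY sequel (no definitions) of `NeukirchUchidaInnerAutomorphisms.lean`.  For a number field `F`
write `G_F = Gal(F̄/F)`.  Neukirch–Uchida attaches to every topological automorphism `α` of `G_F` a
UNIQUE ring automorphism `τ_α` of `F̄` inducing it, and `τ_α(F) = F` (the cell's `thm113₂_unconditional`,
abc-iut-w6-d055 / L4-d2); conversely every ring automorphism of `F̄` preserving `F` induces a unique
topological automorphism of `G_F` (`thm113₂_bijective_unconditional`).  With the criterion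
`exists_eq_conj_iff_ringEquiv_fixes` («`α` is inner iff `τ_α` fixes `F` pointwise») this gives:

* `NeukirchUchida.exists_ringEquiv_restrict` — a ring automorphism `τ` of `F̄` with `τ(F) = F` restricts
  to a field automorphism `φ` of `F`: `τ ∘ ι = ι ∘ φ` (`ι : F → F̄`);
* `NeukirchUchida.forall_exists_eq_conj_iff` — **ALL topological automorphisms of `G_F` are inner iff
  every ring automorphism of `F̄` preserving `F` fixes `F` pointwise**;
* `NeukirchUchida.forall_exists_eq_conj_iff_forall_ringAut_eq_refl` — **… iff `Aut(F)` is trivial**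
  (`∀ φ : F ≃+* F, φ = RingEquiv.refl F`): the outer automorphism group of the topological group
  `G_F` is (in bijection with) `Aut(F)`; in particular for `F = ℚ` every automorphism is inner
  (`rat_forall_exists_eq_conj`, re-deriving `absoluteGaloisGroup_rat_continuousMulEquiv_eq_conj`'s
  existence half from `Aut(ℚ) = 1`).

HONEST FRAMING: classical algebraic number theory, outside the [IUTchIII] Cor. 3.12 cone; nothing here
is an abc claim.

## References
* [NeukirchSchmidtWingberg2008] Neukirch–Schmidt–Wingberg, *Cohomology of Number Fields*, §XII.2.
* [MochizukiAbsAnab2004] S. Mochizuki, *The absolute anabelian geometry of hyperbolic curves*, Thm 1.1.3 p. 6.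
-/

noncomputable section

open scoped Pointwise
open Field
open Literature.NumberTheory.GaloisRepresentations

namespace Literature.AnabelianGeometry.AbsoluteAnabelian

namespace NeukirchUchida

variable {F : Type} [Field F] [NumberField F]

omit [NumberField F] in
/-- A ring automorphism `τ` of `F̄` with `τ(F) = F` (as the image of `ι = algebraMap F F̄`) restricts to a
field automorphism of `F`: there is `φ : F ≃+* F` with `τ (ι a) = ι (φ a)` for all `a`.  Pure algebra.
[cite: NeukirchSchmidtWingberg2008, §XII.2, Cor of Thm (12.2.1)] -/
theorem exists_ringEquiv_restrict (τ : AlgebraicClosure F ≃+* AlgebraicClosure F)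
    (hτ : τ '' Set.range (algebraMap F (AlgebraicClosure F)) = Set.range (algebraMap F (AlgebraicClosure F))) :
    ∃ φ : F ≃+* F, ∀ a : F, τ (algebraMap F (AlgebraicClosure F) a) = algebraMap F (AlgebraicClosure F) (φ a) := by
  classical
  set ι := algebraMap F (AlgebraicClosure F) with hι
  have hinj : Function.Injective ι := (algebraMap F (AlgebraicClosure F)).injective
  -- values of `τ ∘ ι` lie in the range of `ι`
  have hfwd : ∀ a : F, ∃ b : F, τ (ι a) = ι b := fun a => by
    have : τ (ι a) ∈ τ '' Set.range ι := ⟨ι a, ⟨a, rfl⟩, rfl⟩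
    rw [hτ] at this
    obtain ⟨b, hb⟩ := this
    exact ⟨b, hb.symm⟩
  -- values of `τ⁻¹ ∘ ι` lie in the range of `ι`
  have hbwd : ∀ b : F, ∃ a : F, τ.symm (ι b) = ι a := fun b => by
    have : ι b ∈ τ '' Set.range ι := by rw [hτ]; exact ⟨b, rfl⟩
    obtain ⟨y, ⟨a, rfl⟩, hy⟩ := this
    exact ⟨a, by rw [← hy, RingEquiv.symm_apply_apply]⟩
  choose f hf using hfwd
  choose g hg using hbwd
  have hgf : ∀ a, g (f a) = a := fun a => hinj (by rw [← hg, ← hf, RingEquiv.symm_apply_apply])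
  have hfg : ∀ b, f (g b) = b := fun b => hinj (by rw [← hf, ← hg, RingEquiv.apply_symm_apply])
  refine ⟨{ toFun := f, invFun := g, left_inv := hgf, right_inv := hfg,
            map_mul' := fun a b => hinj ?_, map_add' := fun a b => hinj ?_ }, fun a => hf a⟩
  · rw [← hf, map_mul, map_mul, map_mul, hf, hf]
  · rw [← hf, map_add, map_add, map_add, hf, hf]

/-- **All topological automorphisms of `G_F` are inner iff every ring automorphism of `F̄` preserving
`F` fixes `F` pointwise.**  (⇐): the Neukirch–Uchida automorphism `τ_α` preserves `F`
(`thm113₂_unconditional`), so fixes it, so `α` is inner (`exists_eq_conj_of_ringEquiv_fixes`).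
(⇒): a ring automorphism `τ` preserving `F` induces some `α` (`thm113₂_bijective_unconditional`), which
is inner, so `τ` fixes `F` (`ringEquiv_fixes_of_eq_conj`).
[cite: NeukirchSchmidtWingberg2008, §XII.2, Cor of Thm (12.2.1)] -/
theorem forall_exists_eq_conj_iff :
    (∀ α : absoluteGaloisGroup F ≃ₜ* absoluteGaloisGroup F,
        ∃ g : absoluteGaloisGroup F, ∀ σ : absoluteGaloisGroup F, α σ = g * σ * g⁻¹) ↔
      ∀ τ : AlgebraicClosure F ≃+* AlgebraicClosure F,
        τ '' Set.range (algebraMap F (AlgebraicClosure F)) = Set.range (algebraMap F (AlgebraicClosure F)) →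
          ∀ a : F, τ (algebraMap F (AlgebraicClosure F) a) = algebraMap F (AlgebraicClosure F) a := by
  constructor
  · intro h τ hτ
    obtain ⟨α, hα, -⟩ := (thm113₂_bijective_unconditional (F₁ := F) (F₂ := F)).1 τ hτ
    obtain ⟨g, hg⟩ := h α
    exact ringEquiv_fixes_of_eq_conj α g hg τ hα
  · intro h α
    obtain ⟨τ, ⟨hτF, hτ⟩, -⟩ := thm113₂_unconditional (F₁ := F) (F₂ := F) α
    obtain ⟨g, -, hg⟩ := exists_eq_conj_of_ringEquiv_fixes α τ hτ (h τ hτF)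
    exact ⟨g, hg⟩

/-- **All topological automorphisms of `G_F` are inner iff `F` has no nontrivial field automorphism**
(`Aut(F) = 1`): the outer automorphisms of `G_F = Gal(F̄/F)` are exactly the field automorphisms of `F`
(every `φ ∈ Aut(F)` extends to `F̄`, `IsAlgClosure.equivOfEquiv`, and the extension preserves `F`).  For
`F = ℚ` the right-hand side holds, recovering «every automorphism of `G_ℚ` is inner».
[cite: NeukirchSchmidtWingberg2008, §XII.2, Cor of Thm (12.2.1)] -/
theorem forall_exists_eq_conj_iff_forall_ringAut_eq_refl :
    (∀ α : absoluteGaloisGroup F ≃ₜ* absoluteGaloisGroup F,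
        ∃ g : absoluteGaloisGroup F, ∀ σ : absoluteGaloisGroup F, α σ = g * σ * g⁻¹) ↔
      ∀ φ : F ≃+* F, φ = RingEquiv.refl F := by
  rw [forall_exists_eq_conj_iff]
  constructor
  · intro h φ
    -- extend `φ` to `F̄` and read it back on `F`
    let τ : AlgebraicClosure F ≃+* AlgebraicClosure F :=
      IsAlgClosure.equivOfEquiv (AlgebraicClosure F) (AlgebraicClosure F) φ
    have hτa : ∀ a : F, τ (algebraMap F (AlgebraicClosure F) a) = algebraMap F (AlgebraicClosure F) (φ a) :=
      fun a => IsAlgClosure.equivOfEquiv_algebraMap (AlgebraicClosure F) (AlgebraicClosure F) φ a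
    have hτF : τ '' Set.range (algebraMap F (AlgebraicClosure F)) =
        Set.range (algebraMap F (AlgebraicClosure F)) := by
      ext y
      constructor
      · rintro ⟨x, ⟨a, rfl⟩, rfl⟩
        exact ⟨φ a, (hτa a).symm⟩
      · rintro ⟨b, rfl⟩
        exact ⟨algebraMap F _ (φ.symm b), ⟨φ.symm b, rfl⟩, by rw [hτa, RingEquiv.apply_symm_apply]⟩
    apply RingEquiv.ext
    intro a
    have := h τ hτF a
    rw [hτa] at this
    exact (algebraMap F (AlgebraicClosure F)).injective this
  · intro h τ hτF a
    obtain ⟨φ, hφ⟩ := exists_ringEquiv_restrict τ hτF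
    rw [hφ, h φ]
    rfl

/-- `ℚ` has no nontrivial ring automorphism (a ring homomorphism out of `ℚ` is determined:
`RingHom.ext_rat`). [folklore] -/
private theorem rat_ringAut_eq_refl (φ : ℚ ≃+* ℚ) : φ = RingEquiv.refl ℚ :=
  RingEquiv.ext fun x => RingHom.congr_fun (RingHom.ext_rat φ.toRingHom (RingHom.id ℚ)) x

/-- **Consistency with the `ℚ`-core**: the criterion recovers «every topological automorphism of `G_ℚ`
is inner» (existence half of `absoluteGaloisGroup_rat_continuousMulEquiv_eq_conj`) from `Aut(ℚ) = 1`.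
[cite: NeukirchSchmidtWingberg2008, §XII.2, Cor of Thm (12.2.1)] -/
theorem rat_forall_exists_eq_conj (α : absoluteGaloisGroup ℚ ≃ₜ* absoluteGaloisGroup ℚ) :
    ∃ g : absoluteGaloisGroup ℚ, ∀ σ : absoluteGaloisGroup ℚ, α σ = g * σ * g⁻¹ :=
  forall_exists_eq_conj_iff_forall_ringAut_eq_refl.2 rat_ringAut_eq_refl α

end NeukirchUchida

end Literature.AnabelianGeometry.AbsoluteAnabelian

end
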